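import Mathlib.MeasureTheory.Integral.Bochner.Basic
import Mathlib.MeasureTheory.Constructions.Pi
import Mathlib.MeasureTheory.Measure.Lebesgue.Basic
import Mathlib.GroupTheory.FreeAbelianGroup
import Mathlib.RingTheory.Algebraic.Basic
import Mathlib.Analysis.Complex.Basic
import HarnessLib
import HarnessLib.Audit

/-!
# Zagier's conjecture on linear relations among dilogarithm values at algebraic arguments
# (an OPEN conjecture, stated as a named `Prop`; volume / scissors-congruence form)

Topic `Literature/NumberTheory/Transcendental`; ONE named open conjecture (`def … : Prop`,
D-0014: conjectures are never asserted) requested by `wi-11524` for route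
`KontsevichZagierPeriods/HyperbolicBloch` (target `TetraSector` =
`stmt-KontsevichZagierPeriods-3468`, whose inline hypothesis this file names, in the same shape).

**The conjecture** (Zagier; as reported in W. D. Neumann, *Hilbert's 3rd problem and invariants
of 3-manifolds*, Geom. Topol. Monogr. 1 (1998), end of §2, pp. 393–394 of the volume =
arXiv:math/9712226 p. 7–8, read): "any rational linear relation among values of `D₂` at
algebraic arguments must be a consequence of the relations [`D₂(z̄) = −D₂(z)`, misprinted as
`D₂(z) = D₂(z̄)` in the arXiv text; the Bloch–Wigner function is odd under conjugation] and the
five-term functional relation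
`D₂(x) − D₂(y) + D₂(y/x) − D₂((1 − x⁻¹)/(1 − y⁻¹)) + D₂((1 − x)/(1 − y)) = 0`. … Differently
expressed, he conjectures that the volume map is injective on `𝒫(ℚ̄)⁻`" (`𝒫` the pre-Bloch group
`ℤ⟨ℂ ∖ {0,1}⟩/(five-term)`, `⁻` the co-eigenspace of `[z] ↦ −[z̄]`, the volume map
`[z] ↦ D₂(z)` = the hyperbolic volume of the ideal simplex of parameter `z`, Neumann p. 7:
"the volume of an ideal simplex with parameter `z` is `D₂(z)`", `D₂` the Bloch–Wigner
dilogarithm). It contains Milnor's conjecture on the rational independence of the Lobachevsky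
values `D₂(ξ)`, `ξ` primitive roots of unity in the upper half plane (Milnor 1982; Neumann
p. 8), and on the Bloch group `ℬ(ℚ̄) ⊆ 𝒫(ℚ̄)` it is Ramakrishnan's regulator-injectivity
conjecture (Goncharov 1999, Conj. 2.8). See also Zagier, *The dilogarithm function* (2007),
Ch. I §§3–4 (`D(z)`, the five-term relation, `D` as the volume of ideal tetrahedra).

**Rendering (no dilogarithm in Mathlib or the tree).** The value `D₂(z)`, `Im z > 0`, is rendered
GEOMETRICALLY, as the hyperbolic volume of the ideal tetrahedron of `ℍ³` (upper half-space model,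
volume element `dx dy dt/t³`) with vertices `0, 1, z, ∞` (Milnor 1982; Neumann p. 7):
`idealTetrahedronVolume z = ∫_{T(z)} t⁻³`, where `T(z) = idealTetrahedron z` is the solid above the
hemisphere through `0, 1, z` over the open triangle `(0, 1, z)` — verbatim the region of the route.
The relations `D₂(z̄) = −D₂(z)` and `D₂|_ℝ = 0` are built into the relator set, and arguments are
normalised to the upper half plane, so the conjecture reads: for algebraic `z₁, …, z_k` with
`Im zᵢ > 0` and integers `nᵢ`, `Σ nᵢ vol T(zᵢ) = 0` implies that `Σ nᵢ [zᵢ]` lies in the subgroup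
of the free abelian group on `ℂ` generated by the five-term elements with algebraic entries, the
elements `[w] + [w̄]` (`w` algebraic) and the elements `[w]` (`w` real) — `dilogRelators`.

* **`ℤ`-span versus `ℚ`-span.** Neumann's wording ("rational linear relation … consequence of")
  is the `ℚ`-form: `Σ nᵢ[zᵢ] ∈ ℚ·⟨relators⟩`, i.e. `vol ⊗ ℚ` injective on `𝒫(ℚ̄)⁻ ⊗ ℚ`. The
  `ℤ`-form stated here implies it trivially and is equivalent to it because `𝒫(ℚ̄)` is uniquely
  divisible (Suslin; Dupont–Sah 1982 §5; Neumann 1998 Thm 2.10 for `ℂ` and the remark after it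
  for fields containing an algebraically closed field), so that the relator subgroup is saturated
  in `ℤ⟨ℚ̄⟩`. The `ℤ`-form is the one the consumer uses; the equivalence is recorded, not proved.
* Allowing `[w]` for every real `w` (not only real algebraic `w`) among the relators does not
  change the statement: the projection of `FreeAbelianGroup ℂ` killing non-algebraic generators
  maps the larger relator subgroup into the smaller one and fixes `Σ nᵢ[zᵢ]`.
* Junk conventions: `FreeAbelianGroup.of w` for `w ∈ {0, 1}` may occur inside relators only
  through `[w] + [w̄]` / `[w]` real (where `D₂ = 0` anyway); five-term instances require
  `x, y ∉ {0, 1}`, `x ≠ y` (all five arguments in `ℂ ∖ {0,1}`); the Bochner integral of the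
  (integrable, finite-volume) density `t⁻³` over `T(z)` is the genuine volume for `Im z > 0`.

## References

* W. D. Neumann, *Hilbert's 3rd problem and invariants of 3-manifolds*, in: The Epstein birthday
  schrift, Geom. Topol. Monogr. 1 (1998) 383–411: §2 (five-term relation (2.3), `𝒫(ℂ)`,
  Thm 2.10, the volume of an ideal simplex is `D₂(z)`), end of §2.1 discussion pp. 393–394
  (Zagier's conjecture; Milnor's conjecture). [`Neumann1998`]
* D. Zagier, *The dilogarithm function*, in: Frontiers in Number Theory, Physics, and Geometry II
  (2007) 3–65, Ch. I §§3–4. [`Zagier2007Dilogarithm`]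
* A. B. Goncharov, *Volumes of hyperbolic manifolds and mixed Tate motives*, JAMS 12 (1999),
  Conj. 2.8. [`Goncharov1999`]
* J. Milnor, *Hyperbolic geometry: the first 150 years*, Bull. AMS 6 (1982) 9–24. [`Milnor1982`]
* J. L. Dupont, C.-H. Sah, *Scissors congruences II*, J. Pure Appl. Algebra 25 (1982), §5.
  [`DupontSah1982`]
-/

noncomputable section

open MeasureTheory

namespace Literature.NumberTheory.Transcendental

/-- The **ideal tetrahedron `T(z)` of `ℍ³` with vertices `0, 1, z, ∞`** in the upper half-space
model `{(x, y, t) : t > 0}` (coordinates `p 0 = x`, `p 1 = y`, `p 2 = t`): the points above the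
hemisphere through `0, 1, z` (centre on the boundary plane:
`Im z·(x² + y² + t² − x) + (Re z − |z|²)·y > 0`) lying over the open Euclidean triangle with
vertices `0, 1, z` of the boundary plane (`y > 0`, `Re z·y < Im z·x`,
`Im z·(x − 1) < (Re z − 1)·y`); meaningful for `Im z > 0`. Its hyperbolic volume is `D₂(z)`
(Milnor 1982; Neumann 1998 p. 7). Verbatim the region `T z` of route `HyperbolicBloch`.
[cite: Neumann1998, §2 (p. 7: ideal simplices of ℍ³ and their volume D₂(z))] -/
def idealTetrahedron (z : ℂ) : Set (Fin 3 → ℝ) :=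
  {p | 0 < p 1 ∧ z.re * p 1 < z.im * p 0 ∧ z.im * (p 0 - 1) < (z.re - 1) * p 1 ∧ 0 < p 2 ∧
    0 < z.im * (p 0 ^ 2 + p 1 ^ 2 + p 2 ^ 2 - p 0) + (z.re - Complex.normSq z) * p 1}

/-- The **hyperbolic volume of the ideal tetrahedron `(0, 1, z, ∞)`**, `∫_{T(z)} dx dy dt / t³`
(the volume element of `ℍ³` in the upper half-space model); for `Im z > 0` this is the value
`D₂(z)` of the Bloch–Wigner dilogarithm (Milnor 1982; Neumann 1998, p. 7: "the volume of an ideal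
simplex with parameter `z` is `D₂(z)`"), which is how dilogarithm values are rendered in this file.
[cite: Neumann1998, §2 (p. 7, volume of an ideal simplex = D₂(z))] -/
def idealTetrahedronVolume (z : ℂ) : ℝ :=
  ∫ p in idealTetrahedron z, 1 / p 2 ^ 3

/-- The **dilogarithm relators** in the free abelian group on `ℂ`: (i) the five-term elements
`[x] − [y] + [y/x] − [(1 − x⁻¹)/(1 − y⁻¹)] + [(1 − x)/(1 − y)]` (Neumann 1998, (2.3)) with `x, y`
algebraic, `x, y ∉ {0, 1}`, `x ≠ y`; (ii) `[w] + [w̄]` for algebraic `w` (the relation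
`D₂(z̄) = −D₂(z)`, Neumann Thm 2.4 / p. 8); (iii) `[w]` for real `w` (`D₂|_ℝ = 0`, a flat
simplex). Verbatim the generator set of route `HyperbolicBloch`.
[cite: Neumann1998, §2 eq. (2.3) and Thm 2.4] -/
def dilogRelators : Set (FreeAbelianGroup ℂ) :=
  {c : FreeAbelianGroup ℂ | ∃ x y : ℂ, IsAlgebraic ℚ x ∧ IsAlgebraic ℚ y ∧ x ≠ 0 ∧ x ≠ 1 ∧
      y ≠ 0 ∧ y ≠ 1 ∧ x ≠ y ∧ c = FreeAbelianGroup.of x - FreeAbelianGroup.of y +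
        FreeAbelianGroup.of (y / x) - FreeAbelianGroup.of ((1 - x⁻¹) / (1 - y⁻¹)) +
        FreeAbelianGroup.of ((1 - x) / (1 - y))} ∪
    {c | ∃ w : ℂ, IsAlgebraic ℚ w ∧
      c = FreeAbelianGroup.of w + FreeAbelianGroup.of ((starRingEnd ℂ) w)} ∪
    {c | ∃ w : ℂ, w.im = 0 ∧ c = FreeAbelianGroup.of w}

/-- OPEN CONJECTURE — **Zagier's conjecture on `ℚ`-linear relations among dilogarithm values at
algebraic arguments** (as reported by Neumann 1998, end of §2, pp. 393–394: "any rational linear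
relation among values of `D₂` at algebraic arguments must be a consequence of the relations
[`D₂(z̄) = −D₂(z)`, misprinted `D₂(z) = D₂(z̄)` there] and the five-term functional relation …
Differently expressed, … the volume map is injective on `𝒫(ℚ̄)⁻`"; Zagier 2007 Ch. I §§3–4;
it contains Milnor's conjecture (Milnor 1982) and, on `ℬ(ℚ̄)`, Goncharov 1999 Conj. 2.8), in the
volume / `ℤ`-form: for algebraic `z₁, …, z_k` in
the upper half plane and integers `n₁, …, n_k`, if `Σ nᵢ · vol T(zᵢ) = 0`
(`idealTetrahedronVolume`, `= Σ nᵢ D₂(zᵢ)`) then `Σ nᵢ [zᵢ]` lies in the subgroup of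
`FreeAbelianGroup ℂ` generated by `dilogRelators`. The `ℤ`-span form is equivalent to the printed
`ℚ`-span form by the unique divisibility of `𝒫(ℚ̄)` (Suslin; Dupont–Sah 1982 §5; Neumann Thm 2.10)
— see the module docstring. [status: open] — POSED, not proved, in the source (Neumann 1998,
same passage): "even when restricted to `k_n` Zagier's conjecture is much stronger than
Milnor's. Zagier himself has expressed doubt that Milnor's conjecture can be resolved in the
forseeable future"; and (ibid. §1, discussion following Conjecture 1.5) "although it is believed
that the volumes in question are always irrational, it is not known if a single one of them is!".
No `…_holds` is to be expected (CONVENTIONS §4): a conjecture, never asserted; consumers take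
`(h : …)`.
[cite: Neumann1998, §2.1 end (pp. 393–394): Zagier's conjecture] -/
@[conjecture] def ZagierDilogarithmRelationsConjecture : Prop :=
  ∀ (k : ℕ) (z : Fin k → ℂ) (n : Fin k → ℤ), (∀ i, IsAlgebraic ℚ (z i)) → (∀ i, 0 < (z i).im) →
    ∑ i, (n i : ℝ) * idealTetrahedronVolume (z i) = 0 →
      (∑ i, n i • FreeAbelianGroup.of (z i)) ∈ AddSubgroup.closure dilogRelators

/-! ### Unfolding lemmas and the route's inline shape -/

/-- Membership in the ideal tetrahedron, unfolded. [folklore] -/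
theorem mem_idealTetrahedron_iff (z : ℂ) (p : Fin 3 → ℝ) :
    p ∈ idealTetrahedron z ↔ 0 < p 1 ∧ z.re * p 1 < z.im * p 0 ∧
      z.im * (p 0 - 1) < (z.re - 1) * p 1 ∧ 0 < p 2 ∧
      0 < z.im * (p 0 ^ 2 + p 1 ^ 2 + p 2 ^ 2 - p 0) + (z.re - Complex.normSq z) * p 1 :=
  Iff.rfl

/-- The apex direction: every point of `T(z)` has positive height `t = p 2` (so the density
`t⁻³` has no junk on `T(z)`). [folklore] -/
theorem pos_of_mem_idealTetrahedron {z : ℂ} {p : Fin 3 → ℝ} (hp : p ∈ idealTetrahedron z) :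
    0 < p 2 :=
  hp.2.2.2.1

/-- A five-term element with algebraic entries is a relator. [cite: Neumann1998, §2 eq. (2.3)] -/
theorem fiveTerm_mem_dilogRelators {x y : ℂ} (hx : IsAlgebraic ℚ x) (hy : IsAlgebraic ℚ y)
    (hx0 : x ≠ 0) (hx1 : x ≠ 1) (hy0 : y ≠ 0) (hy1 : y ≠ 1) (hxy : x ≠ y) :
    FreeAbelianGroup.of x - FreeAbelianGroup.of y + FreeAbelianGroup.of (y / x) -
        FreeAbelianGroup.of ((1 - x⁻¹) / (1 - y⁻¹)) + FreeAbelianGroup.of ((1 - x) / (1 - y)) ∈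
      dilogRelators :=
  Or.inl (Or.inl ⟨x, y, hx, hy, hx0, hx1, hy0, hy1, hxy, rfl⟩)

/-- `[w] + [w̄]` (`w` algebraic) is a relator (`D₂(z̄) = −D₂(z)`). [cite: Neumann1998, Thm 2.4] -/
theorem of_add_of_conj_mem_dilogRelators {w : ℂ} (hw : IsAlgebraic ℚ w) :
    FreeAbelianGroup.of w + FreeAbelianGroup.of ((starRingEnd ℂ) w) ∈ dilogRelators :=
  Or.inl (Or.inr ⟨w, hw, rfl⟩)

/-- `[w]` (`w` real) is a relator (a flat simplex has volume `0`).
[cite: Neumann1998, §2 (flat simplices)] -/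
theorem of_real_mem_dilogRelators {w : ℂ} (hw : w.im = 0) :
    FreeAbelianGroup.of w ∈ dilogRelators :=
  Or.inr ⟨w, hw, rfl⟩

/-- **The route's inline shape.** For any `T : ℂ → Set (Fin 3 → ℝ)` that is pointwise the ideal
tetrahedron region (the binder `∀ T, (∀ z, T z = {…}) → …` of route `HyperbolicBloch`), Zagier's
conjecture yields the inline hypothesis of `TetraSector` with `T` and the three relator families
written out. PROVED by rewriting `T` to `idealTetrahedron`.
[cite: Neumann1998, §2.1 end (pp. 393–394): Zagier's conjecture] -/
theorem ZagierDilogarithmRelationsConjecture.inline (h : ZagierDilogarithmRelationsConjecture)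
    (T : ℂ → Set (Fin 3 → ℝ))
    (hT : ∀ z, T z = {p | 0 < p 1 ∧ z.re * p 1 < z.im * p 0 ∧ z.im * (p 0 - 1) < (z.re - 1) * p 1 ∧
      0 < p 2 ∧ 0 < z.im * (p 0 ^ 2 + p 1 ^ 2 + p 2 ^ 2 - p 0) + (z.re - Complex.normSq z) * p 1})
    (k : ℕ) (z : Fin k → ℂ) (n : Fin k → ℤ) (hz : ∀ i, IsAlgebraic ℚ (z i))
    (him : ∀ i, 0 < (z i).im) (hrel : ∑ i, (n i : ℝ) * (∫ p in T (z i), 1 / p 2 ^ 3) = 0) :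
    (∑ i, n i • FreeAbelianGroup.of (z i)) ∈ AddSubgroup.closure
      ({c : FreeAbelianGroup ℂ | ∃ x y : ℂ, IsAlgebraic ℚ x ∧ IsAlgebraic ℚ y ∧ x ≠ 0 ∧ x ≠ 1 ∧
          y ≠ 0 ∧ y ≠ 1 ∧ x ≠ y ∧ c = FreeAbelianGroup.of x - FreeAbelianGroup.of y +
            FreeAbelianGroup.of (y / x) - FreeAbelianGroup.of ((1 - x⁻¹) / (1 - y⁻¹)) +
            FreeAbelianGroup.of ((1 - x) / (1 - y))} ∪
        {c | ∃ w : ℂ, IsAlgebraic ℚ w ∧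
          c = FreeAbelianGroup.of w + FreeAbelianGroup.of ((starRingEnd ℂ) w)} ∪
        {c | ∃ w : ℂ, w.im = 0 ∧ c = FreeAbelianGroup.of w}) := by
  have hT' : ∀ w, T w = idealTetrahedron w := fun w => hT w
  have hrel' : ∑ i, (n i : ℝ) * idealTetrahedronVolume (z i) = 0 := by
    simpa only [idealTetrahedronVolume, ← hT'] using hrel
  exact h k z n hz him hrel'

/-- Conversely, the route's inline hypothesis (for some `T` that is pointwise the region) gives
back Zagier's conjecture as named here; so the two are interchangeable in the Theses text.
[cite: Neumann1998, §2.1 end (pp. 393–394): Zagier's conjecture] -/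
theorem ZagierDilogarithmRelationsConjecture.of_inline (T : ℂ → Set (Fin 3 → ℝ))
    (hT : ∀ z, T z = {p | 0 < p 1 ∧ z.re * p 1 < z.im * p 0 ∧ z.im * (p 0 - 1) < (z.re - 1) * p 1 ∧
      0 < p 2 ∧ 0 < z.im * (p 0 ^ 2 + p 1 ^ 2 + p 2 ^ 2 - p 0) + (z.re - Complex.normSq z) * p 1})
    (h : ∀ (k : ℕ) (z : Fin k → ℂ) (n : Fin k → ℤ), (∀ i, IsAlgebraic ℚ (z i)) →
      (∀ i, 0 < (z i).im) → ∑ i, (n i : ℝ) * (∫ p in T (z i), 1 / p 2 ^ 3) = 0 →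
        (∑ i, n i • FreeAbelianGroup.of (z i)) ∈ AddSubgroup.closure
          ({c : FreeAbelianGroup ℂ | ∃ x y : ℂ, IsAlgebraic ℚ x ∧ IsAlgebraic ℚ y ∧ x ≠ 0 ∧
              x ≠ 1 ∧ y ≠ 0 ∧ y ≠ 1 ∧ x ≠ y ∧ c = FreeAbelianGroup.of x - FreeAbelianGroup.of y +
                FreeAbelianGroup.of (y / x) - FreeAbelianGroup.of ((1 - x⁻¹) / (1 - y⁻¹)) +
                FreeAbelianGroup.of ((1 - x) / (1 - y))} ∪
            {c | ∃ w : ℂ, IsAlgebraic ℚ w ∧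
              c = FreeAbelianGroup.of w + FreeAbelianGroup.of ((starRingEnd ℂ) w)} ∪
            {c | ∃ w : ℂ, w.im = 0 ∧ c = FreeAbelianGroup.of w})) :
    ZagierDilogarithmRelationsConjecture := by
  intro k z n hz him hrel
  have hT' : ∀ w, T w = idealTetrahedron w := fun w => hT w
  refine h k z n hz him ?_
  simpa only [idealTetrahedronVolume, ← hT'] using hrel

end Literature.NumberTheory.Transcendental

end
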